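import Summits.BirchSwinnertonDyer.BirchSwinnertonDyer.Theorems.ManinLocalTwoThreeDiscriminantValuationAtThirtyTwo
import Summits.BirchSwinnertonDyer.BirchSwinnertonDyer.Theorems.ManinLocalTwoThreePotOrdinaryShapeTwo
import HarnessLib

/-!
# `64 ∥ N`, `128 ∥ N`, `256 ∥ N`: `v₂(Δ_min)` (and the cheap part of the `c₄` column) BY KODAIRA TYPE — Papadopoulos' rows `f₂ = 6, 7, 8`
# (route `ManinLocalTwoThree`, crux C2 `ManinOddAtFour` stmt-BirchSwinnertonDyer-22967; cell bsd-f2-manin, prover seat p3 gen 15 — the `2⁶/2⁷/2⁸`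
# companions of `…DiscriminantValuationAtThirtyTwo` (p723414) for desc g21's twist-minimal strata `128 ∥ N` (`a₀ = 7`) and `256 ∥ N` (`a₀ = 8`))

For a globally minimal `W/ℚ`, at the place `v₂` of `𝓞 ℚ` over `2` (p3 g12's type lists `kodairaSymbolAt_of_conductorExponent_eq_six/seven/eight_of_irreducible_two`,
read over `ℚ` through the bridges `conductorExponent_vTwo_eq_padicValNat_conductorNorm`, `ordMinimalDiscriminant_eq_addVal_integralModelInt`,
`padicValInt_eq_of_addVal_intCast_toNat` of p723414 and the exact local `c₄` facts already in the tree — p3 g12's `Iₙ*` table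
`IstarCharTwo.addVal_Δ_toNat_of_kodairaSymbolOfMinimal_eq_Istar_succ`, `addVal_c₄_Δ_of_kodairaSymbolOfMinimal_eq_IIstar/IIIstar` of `…PotOrdinaryShapeTwo`):

* **`64 ∥ N` (`f₂ = 6`)**: `II ∧ v₂Δ = 6`, or `I₀* ∧ v₂Δ = 10`, or `I₂* ∧ (v₂Δ, v₂c₄) = (12, 6)`, or `II* ∧ v₂Δ = 14 ∧ 2⁸ ∣ c₄`, or `Iₙ* (n ≥ 4) ∧
  (v₂Δ, v₂c₄) = (n + 10, 6)` — so `v₂Δ ∈ {6, 10, 12} ∪ {14, 15, 16, …}` and the one `Δ`-collision `I₄*/14` vs `II*/14` is separated by `c₄`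
  (`v₂c₄ = 6` vs `2⁸ ∣ c₄`): `kodairaSymbolAt_vTwo_padicValRat_of_padicValNat_conductorNorm_eq_six`;
* **`128 ∥ N` (`f₂ = 7`)**: `II/7`, `III/8`, `I₂*/13` (`v₂c₄ = 6`), `III*/14` (`2⁷ ∣ c₄`) — `v₂Δ ∈ {7, 8, 13, 14}`, types `Δ`-separated:
  `…_eq_seven`, `padicValRat_two_Δ_of_padicValNat_conductorNorm_eq_seven`;
* **`256 ∥ N` (`f₂ = 8`)**: `III/9`, `III*/15` (`2⁷ ∣ c₄`) — `v₂Δ ∈ {9, 15}`: `…_eq_eight`, `padicValRat_two_Δ_of_padicValNat_conductorNorm_eq_eight`.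

HONEST FRAMING.  Local bookkeeping from Tate's algorithm, in print (Papadopoulos 1993, Table IV, `p = 2`), kernel-checked; nothing about C2, Manin's
conjecture or BSD is proved.  No definitions, no named facts, no sorry; axioms standard.

[cite: Papadopoulos1993, Table IV (p = 2): rows with f = 6, 7, 8] [cite: SilvermanATAEC1994, IV.9.4 Steps 3, 4, 6, 7, 9, 10 and Table 4.1; IV.11.1]
-/

set_option autoImplicit false
-- lint-debt: the directory name repeats the summit name (sibling precedent `ManinLocalTwoThreeDiscriminantValuationAtThirtyTwo.lean`)
set_option linter.dupNamespace false

noncomputable section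

open scoped Classical NumberField
open Polynomial IsLocalRing WeierstrassCurve
open IsDiscreteValuationRing hiding maximalIdeal
open Literature.NumberTheory.DiophantineGeometry Literature.NumberTheory.DiophantineGeometry.TateAlgorithm
  Literature.NumberTheory.DiophantineGeometry.TateAlgorithm.CharTwo Literature.NumberTheory.EllipticCurves
open IsDedekindDomain IsDedekindDomain.HeightOneSpectrum Rat.HeightOneSpectrum NumberField
  Summit.BirchSwinnertonDyer.Rank1Residual.GaloisImage

namespace Summit.BirchSwinnertonDyer.BirchSwinnertonDyer.Theorems.ManinLocalTwoThree

/-! ## §1 One more bridge: `p_vᵏ ∣ n` in `𝓞_v` is `pᵏ ∣ n` in `ℤ` -/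

/-- For an integer `n` at a place `v ∣ p` of `𝓞 ℚ`: `pᵏ ∣ n` in `𝓞_v` iff `pᵏ ∣ n` in `ℤ` (`n ∈ 𝔪_vᵏ ⟺ pᵏ ∣ n`). [folklore] -/
theorem pow_dvd_intCast_adicCompletionIntegers_iff (v : HeightOneSpectrum (𝓞 ℚ)) {p : ℕ} (hv : natGenerator v = p) (n : ℤ) (k : ℕ) :
    ((p : ℕ) : v.adicCompletionIntegers ℚ) ^ k ∣ (n : v.adicCompletionIntegers ℚ) ↔ (p : ℤ) ^ k ∣ n := by
  have hirr : Irreducible ((p : ℕ) : v.adicCompletionIntegers ℚ) := hv ▸ irreducible_natGenerator_adicCompletionIntegers v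
  rw [← mem_maximalIdeal_pow_iff_dvd_of_irreducible hirr, intCast_mem_maximalIdeal_adicCompletionIntegers_pow_iff v n k, hv]

section Rows

variable (W : WeierstrassCurve ℚ) [W.IsElliptic] [W.IsGloballyMinimal]

/-! ## §2 The `integralModelInt` package at a place `v ∣ p` of `𝓞 ℚ` -/

/-- **The `integralModelInt` package at a place `v ∣ p`** for a globally minimal `W`: `p` is a uniformiser of `𝓞_v`; Tate's algorithm and
`ord_v Δ_min` are read on `I = integralModelInt W ⊗ 𝓞_v` (`kodairaSymbolAt_eq_kodairaSymbolOfMinimal_integralModelInt`,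
`ordMinimalDiscriminant_eq_addVal_integralModelInt`); and `ord`/divisibility statements about `I.Δ = Δ_min(W)` and `I.c₄ = c₄(W)` in `𝓞_v`
descend to `padicValRat p` / `ℤ`-divisibility statements about `W.Δ`, `W.c₄` (`padicValInt_eq_of_addVal_intCast_toNat`,
`pow_dvd_intCast_adicCompletionIntegers_iff`). [cite: SilvermanAEC2009, VII.1 Prop. 1.3(b) and VIII.8] -/
theorem integralModelInt_adic_package (v : HeightOneSpectrum (𝓞 ℚ)) {p : ℕ} (hv : natGenerator v = p) :
    Irreducible ((p : ℕ) : v.adicCompletionIntegers ℚ) ∧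
    W.kodairaSymbolAt v = ((integralModelInt W).map (Int.castRingHom (v.adicCompletionIntegers ℚ))).kodairaSymbolOfMinimal ∧
    W.ordMinimalDiscriminant v =
      (addVal (v.adicCompletionIntegers ℚ) ((integralModelInt W).map (Int.castRingHom (v.adicCompletionIntegers ℚ))).Δ).toNat ∧
    (∀ {k : ℕ}, k ≠ 0 →
      (addVal (v.adicCompletionIntegers ℚ) ((integralModelInt W).map (Int.castRingHom (v.adicCompletionIntegers ℚ))).Δ).toNat = k →
        padicValRat p W.Δ = k) ∧
    (∀ {k : ℕ}, k ≠ 0 →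
      (addVal (v.adicCompletionIntegers ℚ) ((integralModelInt W).map (Int.castRingHom (v.adicCompletionIntegers ℚ))).c₄).toNat = k →
        padicValRat p W.c₄ = k) ∧
    (∀ {k : ℕ}, ((p : ℕ) : v.adicCompletionIntegers ℚ) ^ k ∣ ((integralModelInt W).map (Int.castRingHom (v.adicCompletionIntegers ℚ))).c₄ →
      ∃ m : ℤ, W.c₄ = (p : ℚ) ^ k * m) := by
  set I := (integralModelInt W).map (Int.castRingHom (v.adicCompletionIntegers ℚ)) with hI
  have hirr : Irreducible ((p : ℕ) : v.adicCompletionIntegers ℚ) := hv ▸ irreducible_natGenerator_adicCompletionIntegers v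
  have hIΔ : I.Δ = ((minimalDiscriminantInt W : ℤ) : v.adicCompletionIntegers ℚ) := by
    rw [hI, map_Δ, eq_intCast]; rfl
  have hIc₄ : I.c₄ = (((integralModelInt W).c₄ : ℤ) : v.adicCompletionIntegers ℚ) := by rw [hI, map_c₄, eq_intCast]
  have hc₄Q : W.c₄ = (((integralModelInt W).c₄ : ℤ) : ℚ) := by
    have h := (integralModelInt W).map_c₄ (Int.castRingHom ℚ)
    rw [map_integralModelInt, eq_intCast] at h
    exact h
  refine ⟨hirr, kodairaSymbolAt_eq_kodairaSymbolOfMinimal_integralModelInt v W, ordMinimalDiscriminant_eq_addVal_integralModelInt v W,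
    fun {k} hk h ↦ ?_, fun {k} hk h ↦ ?_, fun {k} h ↦ ?_⟩
  · rw [← cast_minimalDiscriminantInt W, padicValRat.of_int,
      padicValInt_eq_of_addVal_intCast_toNat v hv (minimalDiscriminantInt W) hk (by rw [← hIΔ]; exact h)]
  · rw [hc₄Q, padicValRat.of_int, padicValInt_eq_of_addVal_intCast_toNat v hv _ hk (by rw [← hIc₄]; exact h)]
  · rw [hIc₄, pow_dvd_intCast_adicCompletionIntegers_iff v hv] at h
    obtain ⟨m, hm⟩ := h
    exact ⟨m, by rw [hc₄Q, hm]; push_cast; ring⟩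

/-! ## §3 The three rows, by type, at the place of `𝓞 ℚ` over `2` -/

/-- **`64 ∥ N`, by type** (`f₂ = 6`): `II/6`, `I₀*/10`, `I₂*/12` (`v₂c₄ = 6`), `II*/14` (`2⁸ ∣ c₄`), or `Iₙ*/(n + 10)`, `n ≥ 4` (`v₂c₄ = 6`); in
particular the types `I₄*` and `II*`, both with `v₂Δ = 14`, are separated by `c₄`. [cite: Papadopoulos1993, Table IV (p = 2), rows with f = 6]
[cite: SilvermanATAEC1994, IV.9.4 Steps 3, 6, 7, 10 and Table 4.1] -/
theorem kodairaSymbolAt_vTwo_padicValRat_of_padicValNat_conductorNorm_eq_six (h6 : padicValNat 2 (W.conductorNorm ℤ) = 6) :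
    (W.kodairaSymbolAt ((primesEquiv (R := 𝓞 ℚ)).symm ⟨2, Nat.prime_two⟩) = .II ∧ padicValRat 2 W.Δ = 6) ∨
    (W.kodairaSymbolAt ((primesEquiv (R := 𝓞 ℚ)).symm ⟨2, Nat.prime_two⟩) = .Istar 0 ∧ padicValRat 2 W.Δ = 10) ∨
    (W.kodairaSymbolAt ((primesEquiv (R := 𝓞 ℚ)).symm ⟨2, Nat.prime_two⟩) = .Istar 2 ∧ padicValRat 2 W.Δ = 12 ∧ padicValRat 2 W.c₄ = 6) ∨
    (W.kodairaSymbolAt ((primesEquiv (R := 𝓞 ℚ)).symm ⟨2, Nat.prime_two⟩) = .IIstar ∧ padicValRat 2 W.Δ = 14 ∧ ∃ m : ℤ, W.c₄ = 2 ^ 8 * m) ∨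
    (∃ n : ℕ, 4 ≤ n ∧ W.kodairaSymbolAt ((primesEquiv (R := 𝓞 ℚ)).symm ⟨2, Nat.prime_two⟩) = .Istar n ∧ padicValRat 2 W.Δ = n + 10 ∧
      padicValRat 2 W.c₄ = 6) := by
  set v : HeightOneSpectrum (𝓞 ℚ) := (primesEquiv (R := 𝓞 ℚ)).symm ⟨2, Nat.prime_two⟩ with hvdef
  have hv : natGenerator v = 2 := congrArg Subtype.val ((primesEquiv (R := 𝓞 ℚ)).apply_symm_apply ⟨2, Nat.prime_two⟩)
  haveI := WeierstrassCurve.perfectField_residueField_adicCompletionIntegers (K := ℚ) v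
  obtain ⟨h2irr, hK, hord, tΔ, tc₄, tdvd⟩ := integralModelInt_adic_package W v hv
  simp only [Nat.cast_ofNat] at h2irr tdvd
  set I := (integralModelInt W).map (Int.castRingHom (v.adicCompletionIntegers ℚ)) with hI
  have hf := conductorExponent_vTwo_eq_padicValNat_conductorNorm W
  rw [h6] at hf
  rcases kodairaSymbolAt_of_conductorExponent_eq_six_of_irreducible_two v W h2irr hf with
      ⟨hT, ho⟩ | ⟨hT, ho⟩ | ⟨hT, ho⟩ | ⟨hT, ho⟩ | ⟨n, hn, hT, ho⟩ <;> rw [hord] at ho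
  · exact Or.inl ⟨hT, by exact_mod_cast tΔ (by norm_num) ho⟩
  · exact Or.inr (Or.inl ⟨hT, by exact_mod_cast tΔ (by norm_num) ho⟩)
  · rw [hK] at hT
    have hΔ0 : I.Δ ≠ 0 := fun h0 ↦ by rw [h0, addVal_zero, ENat.toNat_top] at ho; omega
    have hc : (addVal _ I.c₄).toNat = 6 := by
      rcases IstarCharTwo.addVal_Δ_toNat_of_kodairaSymbolOfMinimal_eq_Istar_succ h2irr I hΔ0 (n := 1) hT with ⟨-, h⟩ | ⟨h6', -⟩
      · exfalso; omega
      · exact h6'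
    exact Or.inr (Or.inr (Or.inl ⟨hK.trans hT, by exact_mod_cast tΔ (by norm_num) ho, by exact_mod_cast tc₄ (by norm_num) hc⟩))
  · rw [hK] at hT
    have hc : (2 : v.adicCompletionIntegers ℚ) ^ 8 ∣ I.c₄ := by
      rcases addVal_c₄_Δ_of_kodairaSymbolOfMinimal_eq_IIstar h2irr I hT with ⟨-, h⟩ | ⟨h8, -⟩
      · exfalso; omega
      · exact h8
    exact Or.inr (Or.inr (Or.inr (Or.inl ⟨hK.trans hT, by exact_mod_cast tΔ (by norm_num) ho, tdvd hc⟩)))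
  · rw [hK] at hT
    obtain ⟨m, rfl⟩ : ∃ m, n = m + 1 := ⟨n - 1, by omega⟩
    have hΔ0 : I.Δ ≠ 0 := fun h0 ↦ by rw [h0, addVal_zero, ENat.toNat_top] at ho; omega
    have hc : (addVal _ I.c₄).toNat = 6 := by
      rcases IstarCharTwo.addVal_Δ_toNat_of_kodairaSymbolOfMinimal_eq_Istar_succ h2irr I hΔ0 (n := m) hT with ⟨-, h⟩ | ⟨h6', -⟩
      · exfalso; omega
      · exact h6'
    refine Or.inr (Or.inr (Or.inr (Or.inr ⟨m + 1, hn, hK.trans hT, ?_, by exact_mod_cast tc₄ (by norm_num) hc⟩)))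
    have := tΔ (k := m + 1 + 10) (by omega) ho
    push_cast at this ⊢
    linarith

/-- **`64 ∥ N ⟹ v₂(Δ_min) ∈ {6, 10, 12}` or `v₂(Δ_min) ≥ 14`** on a globally minimal model. [cite: Papadopoulos1993, Table IV (p = 2), rows with f = 6] -/
theorem padicValRat_two_Δ_of_padicValNat_conductorNorm_eq_six (h6 : padicValNat 2 (W.conductorNorm ℤ) = 6) :
    padicValRat 2 W.Δ = 6 ∨ padicValRat 2 W.Δ = 10 ∨ padicValRat 2 W.Δ = 12 ∨ 14 ≤ padicValRat 2 W.Δ := by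
  rcases kodairaSymbolAt_vTwo_padicValRat_of_padicValNat_conductorNorm_eq_six W h6 with
      ⟨-, h⟩ | ⟨-, h⟩ | ⟨-, h, -⟩ | ⟨-, h, -⟩ | ⟨n, hn, -, h, -⟩
  · exact Or.inl h
  · exact Or.inr (Or.inl h)
  · exact Or.inr (Or.inr (Or.inl h))
  · exact Or.inr (Or.inr (Or.inr (by rw [h])))
  · refine Or.inr (Or.inr (Or.inr ?_))
    rw [h]
    have : (4 : ℤ) ≤ n := by exact_mod_cast hn
    linarith

/-- **`128 ∥ N`, by type** (`f₂ = 7`): `II/7`, `III/8`, `I₂*/13` (`v₂c₄ = 6`), `III*/14` (`2⁷ ∣ c₄`) — `Δ`-separated.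
[cite: Papadopoulos1993, Table IV (p = 2), rows with f = 7] [cite: SilvermanATAEC1994, IV.9.4 Steps 3, 4, 7, 9 and Table 4.1] -/
theorem kodairaSymbolAt_vTwo_padicValRat_of_padicValNat_conductorNorm_eq_seven (h7 : padicValNat 2 (W.conductorNorm ℤ) = 7) :
    (W.kodairaSymbolAt ((primesEquiv (R := 𝓞 ℚ)).symm ⟨2, Nat.prime_two⟩) = .II ∧ padicValRat 2 W.Δ = 7) ∨
    (W.kodairaSymbolAt ((primesEquiv (R := 𝓞 ℚ)).symm ⟨2, Nat.prime_two⟩) = .III ∧ padicValRat 2 W.Δ = 8) ∨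
    (W.kodairaSymbolAt ((primesEquiv (R := 𝓞 ℚ)).symm ⟨2, Nat.prime_two⟩) = .Istar 2 ∧ padicValRat 2 W.Δ = 13 ∧ padicValRat 2 W.c₄ = 6) ∨
    (W.kodairaSymbolAt ((primesEquiv (R := 𝓞 ℚ)).symm ⟨2, Nat.prime_two⟩) = .IIIstar ∧ padicValRat 2 W.Δ = 14 ∧ ∃ m : ℤ, W.c₄ = 2 ^ 7 * m) := by
  set v : HeightOneSpectrum (𝓞 ℚ) := (primesEquiv (R := 𝓞 ℚ)).symm ⟨2, Nat.prime_two⟩ with hvdef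
  have hv : natGenerator v = 2 := congrArg Subtype.val ((primesEquiv (R := 𝓞 ℚ)).apply_symm_apply ⟨2, Nat.prime_two⟩)
  haveI := WeierstrassCurve.perfectField_residueField_adicCompletionIntegers (K := ℚ) v
  obtain ⟨h2irr, hK, hord, tΔ, tc₄, tdvd⟩ := integralModelInt_adic_package W v hv
  simp only [Nat.cast_ofNat] at h2irr tdvd
  set I := (integralModelInt W).map (Int.castRingHom (v.adicCompletionIntegers ℚ)) with hI
  have hf := conductorExponent_vTwo_eq_padicValNat_conductorNorm W
  rw [h7] at hf
  rcases kodairaSymbolAt_of_conductorExponent_eq_seven_of_irreducible_two v W h2irr hf with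
      ⟨hT, ho⟩ | ⟨hT, ho⟩ | ⟨hT, ho⟩ | ⟨hT, ho⟩ <;> rw [hord] at ho
  · exact Or.inl ⟨hT, by exact_mod_cast tΔ (by norm_num) ho⟩
  · exact Or.inr (Or.inl ⟨hT, by exact_mod_cast tΔ (by norm_num) ho⟩)
  · rw [hK] at hT
    have hΔ0 : I.Δ ≠ 0 := fun h0 ↦ by rw [h0, addVal_zero, ENat.toNat_top] at ho; omega
    have hc : (addVal _ I.c₄).toNat = 6 := by
      rcases IstarCharTwo.addVal_Δ_toNat_of_kodairaSymbolOfMinimal_eq_Istar_succ h2irr I hΔ0 (n := 1) hT with ⟨-, h⟩ | ⟨h6', -⟩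
      · exfalso; omega
      · exact h6'
    exact Or.inr (Or.inr (Or.inl ⟨hK.trans hT, by exact_mod_cast tΔ (by norm_num) ho, by exact_mod_cast tc₄ (by norm_num) hc⟩))
  · rw [hK] at hT
    have hc : (2 : v.adicCompletionIntegers ℚ) ^ 7 ∣ I.c₄ := by
      rcases addVal_c₄_Δ_of_kodairaSymbolOfMinimal_eq_IIIstar h2irr I hT with ⟨-, h⟩ | ⟨h7', -⟩
      · exfalso; omega
      · exact h7'
    exact Or.inr (Or.inr (Or.inr ⟨hK.trans hT, by exact_mod_cast tΔ (by norm_num) ho, tdvd hc⟩))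

/-- **`128 ∥ N ⟹ v₂(Δ_min) ∈ {7, 8, 13, 14}`** on a globally minimal model. [cite: Papadopoulos1993, Table IV (p = 2), rows with f = 7] -/
theorem padicValRat_two_Δ_of_padicValNat_conductorNorm_eq_seven (h7 : padicValNat 2 (W.conductorNorm ℤ) = 7) :
    padicValRat 2 W.Δ = 7 ∨ padicValRat 2 W.Δ = 8 ∨ padicValRat 2 W.Δ = 13 ∨ padicValRat 2 W.Δ = 14 := by
  rcases kodairaSymbolAt_vTwo_padicValRat_of_padicValNat_conductorNorm_eq_seven W h7 with
      ⟨-, h⟩ | ⟨-, h⟩ | ⟨-, h, -⟩ | ⟨-, h, -⟩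
  · exact Or.inl h
  · exact Or.inr (Or.inl h)
  · exact Or.inr (Or.inr (Or.inl h))
  · exact Or.inr (Or.inr (Or.inr h))

/-- **`256 ∥ N`, by type** (`f₂ = 8`, the maximal conductor exponent at `2` over `ℚ`): `III/9` or `III*/15` (`2⁷ ∣ c₄`).
[cite: Papadopoulos1993, Table IV (p = 2), rows with f = 8] [cite: SilvermanATAEC1994, IV.9.4 Steps 4, 9 and Table 4.1] -/
theorem kodairaSymbolAt_vTwo_padicValRat_of_padicValNat_conductorNorm_eq_eight (h8 : padicValNat 2 (W.conductorNorm ℤ) = 8) :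
    (W.kodairaSymbolAt ((primesEquiv (R := 𝓞 ℚ)).symm ⟨2, Nat.prime_two⟩) = .III ∧ padicValRat 2 W.Δ = 9) ∨
    (W.kodairaSymbolAt ((primesEquiv (R := 𝓞 ℚ)).symm ⟨2, Nat.prime_two⟩) = .IIIstar ∧ padicValRat 2 W.Δ = 15 ∧ ∃ m : ℤ, W.c₄ = 2 ^ 7 * m) := by
  set v : HeightOneSpectrum (𝓞 ℚ) := (primesEquiv (R := 𝓞 ℚ)).symm ⟨2, Nat.prime_two⟩ with hvdef
  have hv : natGenerator v = 2 := congrArg Subtype.val ((primesEquiv (R := 𝓞 ℚ)).apply_symm_apply ⟨2, Nat.prime_two⟩)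
  haveI := WeierstrassCurve.perfectField_residueField_adicCompletionIntegers (K := ℚ) v
  obtain ⟨h2irr, hK, hord, tΔ, tc₄, tdvd⟩ := integralModelInt_adic_package W v hv
  simp only [Nat.cast_ofNat] at h2irr tdvd
  set I := (integralModelInt W).map (Int.castRingHom (v.adicCompletionIntegers ℚ)) with hI
  have hf := conductorExponent_vTwo_eq_padicValNat_conductorNorm W
  rw [h8] at hf
  rcases kodairaSymbolAt_of_conductorExponent_eq_eight_of_irreducible_two v W h2irr hf with ⟨hT, ho⟩ | ⟨hT, ho⟩ <;> rw [hord] at ho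
  · exact Or.inl ⟨hT, by exact_mod_cast tΔ (by norm_num) ho⟩
  · rw [hK] at hT
    have hc : (2 : v.adicCompletionIntegers ℚ) ^ 7 ∣ I.c₄ := by
      rcases addVal_c₄_Δ_of_kodairaSymbolOfMinimal_eq_IIIstar h2irr I hT with ⟨-, h⟩ | ⟨h7', -⟩
      · exfalso; omega
      · exact h7'
    exact Or.inr ⟨hK.trans hT, by exact_mod_cast tΔ (by norm_num) ho, tdvd hc⟩

/-- **`256 ∥ N ⟹ v₂(Δ_min) ∈ {9, 15}`** on a globally minimal model. [cite: Papadopoulos1993, Table IV (p = 2), rows with f = 8] -/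
theorem padicValRat_two_Δ_of_padicValNat_conductorNorm_eq_eight (h8 : padicValNat 2 (W.conductorNorm ℤ) = 8) :
    padicValRat 2 W.Δ = 9 ∨ padicValRat 2 W.Δ = 15 := by
  rcases kodairaSymbolAt_vTwo_padicValRat_of_padicValNat_conductorNorm_eq_eight W h8 with ⟨-, h⟩ | ⟨-, h, -⟩
  · exact Or.inl h
  · exact Or.inr h

omit [W.IsGloballyMinimal] in
/-- `v₂(N) = k` from `2ᵏ ∥ N`. [folklore] -/
theorem padicValNat_conductorNorm_eq_of_dvd_of_not_dvd {k : ℕ} (hk : 2 ^ k ∣ W.conductorNorm ℤ) (hk' : ¬ 2 ^ (k + 1) ∣ W.conductorNorm ℤ) :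
    padicValNat 2 (W.conductorNorm ℤ) = k := by
  have hN : W.conductorNorm ℤ ≠ 0 := (conductorNorm_pos_holds W).ne'
  rw [padicValNat_dvd_iff_le hN] at hk hk'
  omega

end Rows

end Summit.BirchSwinnertonDyer.BirchSwinnertonDyer.Theorems.ManinLocalTwoThree

end
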